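import Summits.HodgeConjecture.CorCM.Census.CyclicPrimeTypeSquares

/-!
# Faces generate the Hodge lattice of the cyclic slice of prime degree, I: the canonical type squares (one per simple factor of
# defect class `≥ 2`), clearing by defect class, the descent to weight `≤ 1`, and the key lemma on `E ∪ B₁`

COR-CM (cell `pub-hodgecm2`), count-neutral kernel census by the binder seat b09 (gen 25; lane CYCLIC-PRIME-FACES, part III of
`CyclicPrimeTypeModel` → `CyclicPrimeTypeSquares` → `CyclicPrimeFacesDescent` → `CyclicPrimeFacesGenerate` → `CyclicPrimeFacesSlice`).
Bookkeeping definitions + theorems; no `decide` table, no certificate, no named fact, no geometry, no `sorry`.  HC_CM is not proved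
anywhere in this cell; nothing here is a headline and nothing here produces a period.

CONTENT (model of parts I–II; `p` an odd prime).  §1 THE CANONICAL SQUARES: for each simple factor `ω` (b17's
`OddDegreeParityLaw.Orbits p`) of defect class `cls ω ≥ 2` the face `sqFace ω = (rep ω; i, j)` through two defects `i ≠ j` of its
normalised representative (`squares` — one face per simple factor of class `≥ 2`); `spanFaces S` = the span of all Galois
translates of the classes of the faces in `S` (`≤ H` when places are distinct); **`exists_square_through`**: every normalised type
of weight `K ≥ 2` is the main corner of a translated canonical square.  §2 CLEARING (`clear_step`): a vector supported in weight
`≤ K` (`2 ≤ K ≤ p/2`) is, modulo pairs and translates of canonical squares, a vector supported in weight `≤ K − 1` — subtract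
`m(ψ)·(translated square with main corner ψ)` for every `ψ` of weight `K` (its other corners have weights `p − K + 1 > p/2` twice
and `K − 2`, i.e. normalised weights `K − 1, K − 1, K − 2`: `faceVec_apply_of_wt`, `faceVec_apply_add_one_of_wt`) and renormalise;
DESCENT (`descent`, **`exists_reduced`**): every exponent vector is, modulo `pairs ⊔ spanFaces squares`, supported on the labels
of weight `≤ 1` (the curve `E` = the label `0` and the single-defect `p`-fold `B₁` = the labels `δ s`, up to conjugation).
§3 KEY LEMMA (**`eq_smul_weil_of_wt_le_one`**): a Hodge vector supported on the labels of weight `≤ 1` is a multiple of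
`weil = Σ_s e_{δ s} − (p − 2)·e_0` (the Weil class of `E^{p−2} × B₁` of b17's parity-law file, in this labelling), because the form
of `(0,t)` on it reads `r_0 + Σ_s r_{δ s} − 2 r_{δ t} = 0` for every `t`.  Part IV finishes with the class functional and the
closing face.
All [folklore].

## References
* [Pohlmann1968] H. Pohlmann, Algebraic cycles on abelian varieties of complex multiplication type, Ann. of Math. 88 (1968), Thm 1.
* [Milne1999] J. S. Milne, Lefschetz motives and the Tate conjecture, Compositio Math. 117 (1999), Prop. 2.1, p. 54.
-/

namespace Summit.HodgeConjecture.CorCM.Census.CyclicPrimeFacesDescent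

open Finset
open Summit.HodgeConjecture.CorCM.Census.CyclicPrimeTypeModel
open Summit.HodgeConjecture.CorCM.Census.CyclicPrimeTypeSquares

variable (p : ℕ) [hp : Fact p.Prime]

/-! ## §1 The canonical squares and spans of face translates -/

/-- Two distinct defects of a type of weight `≥ 2` (a choice; junk `(0,0)` otherwise). [folklore] -/
noncomputable def pick (ψ : Ty p) : ZMod p × ZMod p :=
  if h : 2 ≤ wt p ψ then ((exists_two_defects p h).choose, (exists_two_defects p h).choose_spec.choose) else (0, 0)

/-- The chosen defects are distinct defects. [folklore] -/
theorem pick_spec {ψ : Ty p} (h : 2 ≤ wt p ψ) :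
    (pick p ψ).1 ≠ (pick p ψ).2 ∧ ψ (pick p ψ).1 = 1 ∧ ψ (pick p ψ).2 = 1 := by
  unfold pick
  rw [dif_pos h]
  exact (exists_two_defects p h).choose_spec.choose_spec

/-- **The canonical square** of a simple factor: the face `(rep ω; i, j)` through two defects of its representative. [folklore] -/
noncomputable def sqFace (ω : OddDegreeParityLaw.Orbits p) : Ty p × ZMod p × ZMod p :=
  (rep p ω, (pick p (rep p ω)).1, (pick p (rep p ω)).2)

/-- The canonical squares: one face per simple factor of defect class `≥ 2`. [folklore] -/
noncomputable def squares : Finset (Ty p × ZMod p × ZMod p) :=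
  (univ.filter fun ω : OddDegreeParityLaw.Orbits p => 2 ≤ cls p ω).image (sqFace p)

/-- The span of all Galois translates of the classes of a family of faces. [folklore] -/
def spanFaces (S : Finset (Ty p × ZMod p × ZMod p)) : Submodule ℤ (Ty p → ℤ) :=
  Submodule.span ℤ {v | ∃ g : ZMod 2 × ZMod p, ∃ f ∈ S, v = transl p g (faceVec p f.1 f.2.1 f.2.2)}

/-- `spanFaces` is monotone. [folklore] -/
theorem spanFaces_mono {S T : Finset (Ty p × ZMod p × ZMod p)} (h : S ⊆ T) : spanFaces p S ≤ spanFaces p T := by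
  refine Submodule.span_mono ?_
  rintro v ⟨g, f, hf, rfl⟩
  exact ⟨g, f, h hf, rfl⟩

/-- `spanFaces S ≤ H` when all faces in `S` have distinct places. [folklore] -/
theorem spanFaces_le_hodge {S : Finset (Ty p × ZMod p × ZMod p)} (h : ∀ f ∈ S, f.2.1 ≠ f.2.2) : spanFaces p S ≤ hodge p := by
  refine Submodule.span_le.mpr ?_
  rintro v ⟨g, f, hf, rfl⟩
  exact transl_mem p (faceVec_mem p f.1 (h f hf)) g

/-- The canonical squares have distinct places. [folklore] -/
theorem squares_places {f : Ty p × ZMod p × ZMod p} (hf : f ∈ squares p) : f.2.1 ≠ f.2.2 := by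
  obtain ⟨ω, hω, rfl⟩ := Finset.mem_image.mp hf
  have h2 : 2 ≤ wt p (rep p ω) := by rw [wt_rep]; exact (Finset.mem_filter.mp hω).2
  exact (pick_spec p h2).1

/-- **Every normalised type of weight `K ≥ 2` is the main corner of a translated canonical square**: some element of
`spanFaces squares` is the class of a face `(ψ; i, j)` through two defects of `ψ`. [folklore] -/
theorem exists_square_through (hp2 : p ≠ 2) {ψ : Ty p} (h2 : 2 ≤ wt p ψ) (hn : wt p ψ ≤ p / 2) :
    ∃ v ∈ spanFaces p (squares p), ∃ i j : ZMod p, i ≠ j ∧ ψ i = 1 ∧ ψ j = 1 ∧ v = faceVec p ψ i j := by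
  have hlt : wt p ψ < p := by have hodd2 : p % 2 = 1 := hp.out.mod_two_eq_one_iff_ne_two.mpr hp2; omega
  have hnc : ¬ ∀ y, ψ y = ψ 0 := nonconst_of_wt p (by omega) hlt
  set ω : OddDegreeParityLaw.Orbits p := Quotient.mk _ (⟨ψ, hnc⟩ : OddDegreeParityLaw.Nonconst (ZMod p)) with hω
  have hcls : cls p ω = wt p ψ := by
    rw [hω, cls_mk]
    show min (wt p ψ) (p - wt p ψ) = wt p ψ
    omega
  obtain ⟨t, ht⟩ := exists_tw_rep p hp2 ⟨ψ, hnc⟩ hn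
  have ht' : tw p (0, t) (rep p ω) = ψ := ht
  have hrep2 : 2 ≤ wt p (rep p ω) := by rw [wt_rep, hcls]; exact h2
  obtain ⟨hij, hi, hj⟩ := pick_spec p hrep2
  set i₀ := (pick p (rep p ω)).1
  set j₀ := (pick p (rep p ω)).2
  refine ⟨transl p (0, t) (faceVec p (rep p ω) i₀ j₀), ?_, i₀ - t, j₀ - t, ?_, ?_, ?_, ?_⟩
  · refine Submodule.subset_span ⟨(0, t), sqFace p ω, ?_, rfl⟩
    exact Finset.mem_image.mpr ⟨ω, Finset.mem_filter.mpr ⟨Finset.mem_univ _, by rw [hcls]; exact h2⟩, rfl⟩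
  · exact fun h => hij (sub_left_injective h)
  · rw [← ht']; simp only [tw, sub_add_cancel, add_zero]; exact hi
  · rw [← ht']; simp only [tw, sub_add_cancel, add_zero]; exact hj
  · rw [transl_faceVec, ht']

/-! ## §2 Clearing by defect class and the descent -/

/-- Values of a face class. [folklore] -/
theorem faceVec_apply (φ : Ty p) (i j : ZMod p) (χ : Ty p) :
    faceVec p φ i j χ = (if χ = φ then 1 else 0) + (if χ = φ + 1 + δ p i then 1 else 0) +
      (if χ = φ + 1 + δ p j then 1 else 0) + (if χ = φ + δ p i + δ p j then 1 else 0) := by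
  simp only [faceVec, Pi.add_apply, Pi.single_apply]

/-- A face class through two defects of a normalised `φ` of weight `K` vanishes at every label of weight in `[K, p/2]` other
than `φ`, and at `φ` it is `1`. [folklore] -/
theorem faceVec_apply_of_wt (hp2 : p ≠ 2) {φ : Ty p} {i j : ZMod p} (hi : φ i = 1) (hj : φ j = 1) (hij : i ≠ j)
    (hφ : wt p φ ≤ p / 2) (χ : Ty p) (hχ : wt p φ ≤ wt p χ) (hχ' : wt p χ ≤ p / 2) :
    faceVec p φ i j χ = if χ = φ then 1 else 0 := by
  have hodd : p % 2 = 1 := hp.out.mod_two_eq_one_iff_ne_two.mpr hp2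
  have hwφ := wt_le p φ
  have h2φ : 2 ≤ wt p φ := by
    unfold wt
    exact Finset.one_lt_card_iff.mpr ⟨i, j, by simp [hi], by simp [hj], hij⟩
  rw [faceVec_apply]
  have h2 : χ ≠ φ + 1 + δ p i := by
    intro h; have := congrArg (wt p) h; rw [wt_corner_bar p hi] at this; omega
  have h3 : χ ≠ φ + 1 + δ p j := by
    intro h; have := congrArg (wt p) h; rw [wt_corner_bar p hj] at this; omega
  have h4 : χ ≠ φ + δ p i + δ p j := by
    intro h; have := congrArg (wt p) h; rw [wt_corner_flip p hi hj hij] at this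
    omega
  rw [if_neg h2, if_neg h3, if_neg h4, add_zero, add_zero, add_zero]

/-- The same face class vanishes at the conjugate `χ + 1` of every normalised label of weight `≥ K`. [folklore] -/
theorem faceVec_apply_add_one_of_wt (hp2 : p ≠ 2) {φ : Ty p} {i j : ZMod p} (hi : φ i = 1) (hj : φ j = 1) (hij : i ≠ j)
    (hφ : wt p φ ≤ p / 2) (χ : Ty p) (hχ : wt p φ ≤ wt p χ) (hχ' : wt p χ ≤ p / 2) :
    faceVec p φ i j (χ + 1) = 0 := by
  have hodd : p % 2 = 1 := hp.out.mod_two_eq_one_iff_ne_two.mpr hp2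
  have hwφ := wt_le p φ
  have hwχ := wt_le p χ
  have h2φ : 2 ≤ wt p φ := by
    unfold wt
    exact Finset.one_lt_card_iff.mpr ⟨i, j, by simp [hi], by simp [hj], hij⟩
  have hw1 : wt p (χ + 1) = p - wt p χ := wt_add_one p χ
  rw [faceVec_apply]
  have h1 : χ + 1 ≠ φ := by
    intro h; have := congrArg (wt p) h; omega
  have h2 : χ + 1 ≠ φ + 1 + δ p i := by
    intro h
    have h' : χ = φ + 1 + δ p i + 1 := by rw [← h, add_one_add_one]
    have := congrArg (wt p) h'; rw [wt_corner_bar_add_one p hi] at this; omega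
  have h3 : χ + 1 ≠ φ + 1 + δ p j := by
    intro h
    have h' : χ = φ + 1 + δ p j + 1 := by rw [← h, add_one_add_one]
    have := congrArg (wt p) h'; rw [wt_corner_bar_add_one p hj] at this; omega
  have h4 : χ + 1 ≠ φ + δ p i + δ p j := by
    intro h; have := congrArg (wt p) h; rw [wt_corner_flip p hi hj hij] at this; omega
  rw [if_neg h1, if_neg h2, if_neg h3, if_neg h4, add_zero, add_zero, add_zero]

/-- **Clearing step.**  A vector supported in weight `≤ K`, `2 ≤ K ≤ p/2`, is congruent modulo `pairs ⊔ spanFaces squares` to a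
vector supported in weight `≤ K − 1`. [folklore] -/
theorem clear_step (hp2 : p ≠ 2) {K : ℕ} (hK2 : 2 ≤ K) (hKp : K ≤ p / 2) (m : Ty p → ℤ)
    (hm : ∀ χ, m χ ≠ 0 → wt p χ ≤ K) :
    ∃ m' : Ty p → ℤ, (∀ χ, m' χ ≠ 0 → wt p χ ≤ K - 1) ∧ m - m' ∈ pairs p ⊔ spanFaces p (squares p) := by
  have hodd : p % 2 = 1 := hp.out.mod_two_eq_one_iff_ne_two.mpr hp2
  -- one translated canonical square through each label of weight `K`
  have hF : ∀ ψ : Ty p, wt p ψ = K → ∃ v : Ty p → ℤ, v ∈ spanFaces p (squares p) ∧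
      ∃ i j : ZMod p, i ≠ j ∧ ψ i = 1 ∧ ψ j = 1 ∧ v = faceVec p ψ i j := by
    intro ψ hψ
    obtain ⟨v, hv, i, j, hij, hi, hj, rfl⟩ := exists_square_through p hp2 (ψ := ψ) (by omega) (by omega)
    exact ⟨_, hv, i, j, hij, hi, hj, rfl⟩
  choose! F hFmem ci cj hcij hci hcj hFeq using hF
  set L : Finset (Ty p) := univ.filter fun ψ => wt p ψ = K with hL
  set q : Ty p → ℤ := ∑ ψ ∈ L, m ψ • F ψ with hq
  have hqmem : q ∈ spanFaces p (squares p) :=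
    Submodule.sum_mem _ fun ψ hψ => Submodule.smul_mem _ _ (hFmem ψ (Finset.mem_filter.mp hψ).2)
  -- values of `q`
  have hqval : ∀ χ : Ty p, K ≤ wt p χ → wt p χ ≤ p / 2 → q χ = if wt p χ = K then m χ else 0 := by
    intro χ hχ hχ'
    rw [hq, Finset.sum_apply]
    have hterm : ∀ ψ ∈ L, (m ψ • F ψ) χ = if χ = ψ then m ψ else 0 := by
      intro ψ hψ
      have hψK : wt p ψ = K := (Finset.mem_filter.mp hψ).2
      rw [Pi.smul_apply, smul_eq_mul, hFeq ψ hψK,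
        faceVec_apply_of_wt p hp2 (hci ψ hψK) (hcj ψ hψK) (hcij ψ hψK) (by omega) χ (by omega) hχ']
      split_ifs <;> ring
    rw [Finset.sum_congr rfl hterm, Finset.sum_ite_eq]
    have hLmem : χ ∈ L ↔ wt p χ = K := by rw [hL]; simp
    by_cases hχK : wt p χ = K
    · rw [if_pos (hLmem.mpr hχK), if_pos hχK]
    · rw [if_neg (fun h => hχK (hLmem.mp h)), if_neg hχK]
  have hqval' : ∀ χ : Ty p, K ≤ wt p χ → wt p χ ≤ p / 2 → q (χ + 1) = 0 := by
    intro χ hχ hχ'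
    rw [hq, Finset.sum_apply]
    refine Finset.sum_eq_zero fun ψ hψ => ?_
    have hψK : wt p ψ = K := (Finset.mem_filter.mp hψ).2
    rw [Pi.smul_apply, smul_eq_mul, hFeq ψ hψK,
      faceVec_apply_add_one_of_wt p hp2 (hci ψ hψK) (hcj ψ hψK) (hcij ψ hψK) (by omega) χ (by omega) hχ', mul_zero]
  refine ⟨nrm p (m - q), ?_, ?_⟩
  · intro χ hχ
    have hn : wt p χ ≤ p / 2 := wt_le_of_nrm_ne_zero p _ hχ
    by_contra hK
    apply hχ
    have hKle : K ≤ wt p χ := by omega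
    simp only [nrm, if_pos hn, Pi.sub_apply]
    rw [hqval χ hKle hn, hqval' χ hKle hn]
    have hm1 : m (χ + 1) = 0 := by
      by_contra h
      have := hm _ h
      rw [wt_add_one] at this
      omega
    rw [hm1]
    by_cases hχK : wt p χ = K
    · rw [if_pos hχK]; ring
    · rw [if_neg hχK]
      have hm0 : m χ = 0 := by
        by_contra h; exact hχK (le_antisymm (hm _ h) hKle)
      rw [hm0]; ring
  · have : m - nrm p (m - q) = (m - q - nrm p (m - q)) + q := by abel
    rw [this]
    exact Submodule.add_mem _ (Submodule.mem_sup_left (sub_nrm_mem_pairs p hp2 _)) (Submodule.mem_sup_right hqmem)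

/-- **Descent.**  A vector supported in weight `≤ K ≤ p/2` is congruent modulo `pairs ⊔ spanFaces squares` to a vector supported
in weight `≤ 1`. [folklore] -/
theorem descent (hp2 : p ≠ 2) (K : ℕ) (hKp : K ≤ p / 2) (m : Ty p → ℤ) (hm : ∀ χ, m χ ≠ 0 → wt p χ ≤ K) :
    ∃ r : Ty p → ℤ, (∀ χ, r χ ≠ 0 → wt p χ ≤ 1) ∧ m - r ∈ pairs p ⊔ spanFaces p (squares p) := by
  induction K generalizing m with
  | zero => exact ⟨m, fun χ h => (hm χ h).trans (Nat.zero_le 1), by rw [sub_self]; exact Submodule.zero_mem _⟩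
  | succ K ih =>
    by_cases hK1 : K + 1 ≤ 1
    · exact ⟨m, fun χ h => (hm χ h).trans hK1, by rw [sub_self]; exact Submodule.zero_mem _⟩
    · obtain ⟨m', hm', hdiff⟩ := clear_step p hp2 (K := K + 1) (by omega) hKp m hm
      obtain ⟨r, hr, hdiff'⟩ := ih (by omega) m' (fun χ h => by have := hm' χ h; omega)
      refine ⟨r, hr, ?_⟩
      have : m - r = (m - m') + (m' - r) := by abel
      rw [this]
      exact Submodule.add_mem _ hdiff hdiff'

/-- **Every exponent vector is, modulo pairs and translates of canonical squares, supported on the labels of weight `≤ 1`**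
(the curve `E` and the single-defect factor `B₁`). [folklore] -/
theorem exists_reduced (hp2 : p ≠ 2) (m : Ty p → ℤ) :
    ∃ r : Ty p → ℤ, (∀ χ, r χ ≠ 0 → wt p χ ≤ 1) ∧ m - r ∈ pairs p ⊔ spanFaces p (squares p) := by
  obtain ⟨r, hr, hdiff⟩ := descent p hp2 (p / 2) le_rfl (nrm p m) (fun χ h => wt_le_of_nrm_ne_zero p m h)
  refine ⟨r, hr, ?_⟩
  have : m - r = (m - nrm p m) + (nrm p m - r) := by abel
  rw [this]
  exact Submodule.add_mem _ (Submodule.mem_sup_left (sub_nrm_mem_pairs p hp2 m)) hdiff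

/-! ## §3 The key lemma: Hodge vectors supported on `E ∪ B₁` are multiples of the Weil vector -/

omit hp in
/-- Values of `δ`: `δ s ≠ 0`. [folklore] -/
theorem delta_ne_zero (s : ZMod p) : δ p s ≠ (0 : Ty p) := by
  intro h
  have := congrFun h s
  rw [delta_apply, if_pos rfl, Pi.zero_apply] at this
  exact absurd this (by decide)

omit hp in
/-- `δ` is injective. [folklore] -/
theorem delta_inj {s s' : ZMod p} (h : δ p s = δ p s') : s = s' := by
  by_contra hne
  have := congrFun h s
  rw [delta_apply, delta_apply, if_pos rfl, if_neg hne] at this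
  exact absurd this (by decide)

/-- Weight of `0` and of `δ s`. [folklore] -/
theorem wt_zero : wt p (0 : Ty p) = 0 := by
  unfold wt
  rw [Finset.card_eq_zero]
  ext s; simp

/-- Weight of `δ s` is `1`. [folklore] -/
theorem wt_delta (s : ZMod p) : wt p (δ p s) = 1 := by
  have h : δ p s = ind p {s} := by funext s'; simp [ind, delta_apply]
  rw [h, wt_ind, Finset.card_singleton]

/-- The Weil vector of `E^{p−2} × B₁` in the representative-free labelling: `Σ_s e_{δ s} − (p − 2)·e_0`. [folklore] -/
def weil : Ty p → ℤ := ∑ s : ZMod p, Pi.single (δ p s) 1 - ((p : ℤ) - 2) • Pi.single (0 : Ty p) 1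

/-- The form of `(0,t)` on `Σ_s c_s e_{δ s}`: `Σ_s c_s − 2 c_t`. [folklore] -/
theorem coef_zero_dotProduct_sum_delta (t : ZMod p) (c : ZMod p → ℤ) :
    coef p (0, t) ⬝ᵥ (∑ s : ZMod p, c s • Pi.single (δ p s) (1 : ℤ)) = (∑ s : ZMod p, c s) - 2 * c t := by
  rw [dotProduct_sum]
  have hterm : ∀ s : ZMod p, coef p (0, t) ⬝ᵥ (c s • Pi.single (δ p s) (1 : ℤ)) = c s - 2 * (if t = s then c s else 0) := by
    intro s
    rw [dotProduct_smul, coef_zero_dotProduct_single, mul_one, smul_eq_mul, delta_apply]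
    by_cases hts : t = s
    · rw [if_pos hts, if_pos hts, if_neg (by decide)]; ring
    · rw [if_neg hts, if_neg hts, if_pos rfl]; ring
  simp_rw [hterm]
  rw [Finset.sum_sub_distrib, ← Finset.mul_sum, Finset.sum_ite_eq, if_pos (Finset.mem_univ _)]

/-- The form of `(0,t)` on `c • e_0` is `c`. [folklore] -/
theorem coef_zero_dotProduct_single_zero (t : ZMod p) (c : ℤ) :
    coef p (0, t) ⬝ᵥ (c • Pi.single (0 : Ty p) (1 : ℤ)) = c := by
  rw [dotProduct_smul, coef_zero_dotProduct_single, smul_eq_mul]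
  simp

/-- **Key lemma.**  A Hodge vector supported on the labels of weight `≤ 1` is `r(δ 0) • weil`. [folklore] -/
theorem eq_smul_weil_of_wt_le_one (r : Ty p → ℤ) (hr : r ∈ hodge p) (hsupp : ∀ χ, r χ ≠ 0 → wt p χ ≤ 1) :
    r = r (δ p 0) • weil p := by
  -- (a) explicit form of `r`
  set R : Ty p → ℤ := ∑ s : ZMod p, r (δ p s) • Pi.single (δ p s) 1 + r 0 • Pi.single (0 : Ty p) 1 with hR
  have hRval : ∀ χ : Ty p, R χ = (if ∃ s, χ = δ p s then r χ else 0) + (if χ = 0 then r χ else 0) := by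
    intro χ
    rw [hR, Pi.add_apply, Finset.sum_apply, Pi.smul_apply, smul_eq_mul, Pi.single_apply]
    simp only [Pi.smul_apply, smul_eq_mul, Pi.single_apply]
    congr 1
    · by_cases h : ∃ s, χ = δ p s
      · obtain ⟨s, rfl⟩ := h
        rw [if_pos ⟨s, rfl⟩]
        have : ∀ s' : ZMod p, r (δ p s') * (if δ p s = δ p s' then (1 : ℤ) else 0) = if s = s' then r (δ p s') else 0 := by
          intro s'
          by_cases hss : s = s'
          · subst hss; simp
          · rw [if_neg (fun h => hss (delta_inj p h)), if_neg hss, mul_zero]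
        rw [Finset.sum_congr rfl fun s' _ => this s', Finset.sum_ite_eq, if_pos (Finset.mem_univ _)]
      · rw [if_neg h]
        refine Finset.sum_eq_zero fun s' _ => ?_
        rw [if_neg (fun hh => h ⟨s', hh⟩), mul_zero]
    · by_cases h : χ = 0
      · subst h; simp
      · rw [if_neg h, if_neg h, mul_zero]
  have hrR : r = R := by
    funext χ
    rw [hRval]
    by_cases h1 : ∃ s, χ = δ p s
    · obtain ⟨s, rfl⟩ := h1
      rw [if_pos ⟨s, rfl⟩, if_neg (delta_ne_zero p s), add_zero]
    · by_cases h0 : χ = 0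
      · subst h0; rw [if_neg h1, if_pos rfl, zero_add]
      · rw [if_neg h1, if_neg h0, add_zero]
        by_contra hne
        rcases eq_zero_or_eq_delta_of_wt_le_one p (hsupp χ hne) with h | ⟨s, hs⟩
        · exact h0 h
        · exact h1 ⟨s, hs⟩
  -- (b) the forms of `(0,t)` on `R`
  have hform : ∀ t : ZMod p, coef p (0, t) ⬝ᵥ R = (∑ s : ZMod p, r (δ p s)) - 2 * r (δ p t) + r 0 := by
    intro t
    rw [hR, dotProduct_add, coef_zero_dotProduct_sum_delta, coef_zero_dotProduct_single_zero]
  have hzero : ∀ t : ZMod p, coef p (0, t) ⬝ᵥ R = 0 := by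
    intro t; rw [← hrR]; exact hr (0, t)
  -- (c) the coefficients on `B₁` are constant
  have hconst : ∀ s : ZMod p, r (δ p s) = r (δ p 0) := by
    intro s
    have h1 := hzero s
    have h2 := hzero 0
    rw [hform] at h1 h2
    linarith
  -- (d) the `E`-coefficient
  have hE : r 0 = -(((p : ℤ) - 2) * r (δ p 0)) := by
    have h2 := hzero 0
    rw [hform, Finset.sum_congr rfl fun s _ => hconst s, Finset.sum_const, Finset.card_univ, ZMod.card,
      nsmul_eq_mul] at h2
    linarith
  -- (e) assemble
  have hRw : R = r (δ p 0) • weil p := by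
    rw [hR, weil, smul_sub, Finset.smul_sum, smul_smul, Finset.sum_congr rfl fun s _ => by rw [hconst s], hE]
    have hc : r (δ p 0) * ((p : ℤ) - 2) = ((p : ℤ) - 2) * r (δ p 0) := mul_comm _ _
    rw [hc, neg_smul, ← sub_eq_add_neg]
  exact hrR.trans hRw

end Summit.HodgeConjecture.CorCM.Census.CyclicPrimeFacesDescent
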